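import Mathlib.MeasureTheory.Integral.Marginal
import Mathlib.MeasureTheory.Group.LIntegral
import Mathlib.MeasureTheory.Measure.Haar.Unique
import Mathlib.MeasureTheory.Measure.Lebesgue.Basic
import HarnessLib

/-!
# Convolution powers of a non-negative weight on the real line

HONEST FRAMING: exact (Metropolis-corrected) sampling algorithms for lattice gauge theory;
figures of merit are autocorrelation/cost numbers at stated couplings and volumes; no
continuum-physics claim.

Venture `LatticeQCDFlow` (cell pub-lqcd), sub-topic `Scoring`; FANOUT row 5 (`s0-sun-a`), GEN-8.
NEW WORK of the cell (placement rule), support file for the exact TOPOLOGICAL-CHARGE LAW of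
two-dimensional `U(1)` lattice gauge theory (`Scoring/U1TorusTopologicalChargeLaw.lean`): the
cell's exact 2-d oracle (`ref-exact` `ORACLE-u1-2d.json`, field `pi_k`) states the sector weights
as "`π_k = g_V(2πk) / Σ_j g_V(2πj)`, `g_V` = the `V`-fold convolution of `p(θ) ∝ e^{β cos θ}` on one
period".  This file supplies the real-line convolution calculus behind that sentence, for
`[0, ∞]`-valued weights and Lebesgue measure (no integrability bookkeeping):

* `lconv w φ y = ∫⁻ t, φ (y − t) · w t` — convolution with the weight `w`; `convPow w n = (lconv w)^[n] w`
  is the `(n+1)`-FOLD CONVOLUTION POWER `w^{*(n+1)}`;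
* `lconv_eq_lintegral_mul` (the symmetric form `∫⁻ t, φ t · w (y − t)`), measurability, the sup bound
  `convPow w n ≤ (sup w) · (∫ w)^n` (`convPow_le`), evenness (`convPow_neg` for even `w`), and
  invariance under a.e.-modification of the weight (`convPow_congr_ae`, `n ≥ 1`);
* **`lmarginal_eq_iterate_lconv`** / **`lintegral_eq_iterate_lconv`** — INTEGRATING OUT INDEPENDENT
  INCREMENTS: for a finite index set `R`,
  `∫⋯∫_R φ(a − Σ_{r∈R} t_r) · ∏_{r∈R} w(t_r) dt_R = ((lconv w)^{#R} φ)(a)`, in particular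
  `∫_{ℝ^ι} w(y − Σ_i t_i) · ∏_i w(t_i) dt = (convPow w |ι|)(y) = w^{*(|ι|+1)}(y)`
  (**`lintegral_eq_convPow`**) — the density of a sum of `|ι| + 1` independent increments.

Elementary (Tonelli over `MeasureTheory.lmarginal`, translation/reflection invariance of Lebesgue
measure); nothing is cited; the pattern follows the multiplicative Haar-convolution files
`Scaling/HaarConvolutionRatio.lean` / `Scaling/PlaquetteMarginals2D.lean` of the cell.  NOT here:
Fourier representation of the powers, Young / `L^p` statements, Mathlib's Bochner `convolution`.
-/

noncomputable section

open MeasureTheory Set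
open scoped ENNReal

namespace Summit.Ventures.LatticeQCDFlow.Scoring

/-! ### 1. Convolution with a weight and its powers -/

/-- Convolution on the real line against Lebesgue measure, `[0,∞]`-valued:
`(lconv w φ)(y) = ∫⁻ t, φ (y − t) · w t`. -/
def lconv (w φ : ℝ → ℝ≥0∞) (y : ℝ) : ℝ≥0∞ := ∫⁻ t, φ (y - t) * w t

/-- Convolution powers of a weight: `convPow w n = (lconv w)^[n] w = w^{*(n+1)}`, the `(n+1)`-fold
convolution of `w` with itself (`convPow w 0 = w`). -/
def convPow (w : ℝ → ℝ≥0∞) (n : ℕ) : ℝ → ℝ≥0∞ := (lconv w)^[n] w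

variable {w w' φ φ' : ℝ → ℝ≥0∞} {A : ℝ≥0∞}

/-- `convPow w 0 = w`. -/
@[simp] theorem convPow_zero (w : ℝ → ℝ≥0∞) : convPow w 0 = w := rfl

/-- `convPow w (n+1) = lconv w (convPow w n)`. -/
theorem convPow_succ (w : ℝ → ℝ≥0∞) (n : ℕ) : convPow w (n + 1) = lconv w (convPow w n) := by
  rw [convPow, Function.iterate_succ_apply']
  rfl

/-- The symmetric form of the convolution: `(lconv w φ)(y) = ∫⁻ t, φ t · w (y − t)` (substitute
`t ↦ y − t`; Lebesgue measure is translation and reflection invariant). -/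
theorem lconv_eq_lintegral_mul (w φ : ℝ → ℝ≥0∞) (y : ℝ) :
    lconv w φ y = ∫⁻ t, φ t * w (y - t) := by
  rw [lconv, ← lintegral_sub_left_eq_self (fun t => φ t * w (y - t)) y]
  refine lintegral_congr fun t => ?_
  simp only [sub_sub_cancel]

/-- `lconv w φ` is measurable for measurable `w`, `φ` (Tonelli measurability of a parametric
integral). -/
theorem measurable_lconv (hw : Measurable w) (hφ : Measurable φ) : Measurable (lconv w φ) := by
  have h : Measurable fun p : ℝ × ℝ => φ (p.1 - p.2) * w p.2 :=
    (hφ.comp (measurable_fst.sub measurable_snd)).mul (hw.comp measurable_snd)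
  exact h.lintegral_prod_right'

/-- Every iterate `(lconv w)^[n] φ` is measurable. -/
theorem measurable_iterate_lconv (hw : Measurable w) (hφ : Measurable φ) (n : ℕ) :
    Measurable ((lconv w)^[n] φ) := by
  induction n with
  | zero => exact hφ
  | succ n ih => rw [Function.iterate_succ_apply']; exact measurable_lconv hw ih

/-- The convolution powers are measurable. -/
theorem measurable_convPow (hw : Measurable w) (n : ℕ) : Measurable (convPow w n) :=
  measurable_iterate_lconv hw hw n

/-! ### 2. Sup bound, evenness, a.e.-modification of the weight -/

/-- Sup bound: `(lconv w φ)(y) ≤ (sup φ) · ∫⁻ w`. -/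
theorem lconv_le (hw : Measurable w) (hφ : ∀ s, φ s ≤ A) (y : ℝ) :
    lconv w φ y ≤ A * ∫⁻ t, w t := by
  rw [lconv, ← lintegral_const_mul _ hw]
  exact lintegral_mono fun t => mul_le_mul' (hφ _) le_rfl

/-- Sup bound for the iterates: `(lconv w)^[n] φ ≤ (sup φ) · (∫⁻ w)^n`. -/
theorem iterate_lconv_le (hw : Measurable w) (hφ : ∀ s, φ s ≤ A) (n : ℕ) (y : ℝ) :
    (lconv w)^[n] φ y ≤ A * (∫⁻ t, w t) ^ n := by
  induction n generalizing y with
  | zero => simpa using hφ y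
  | succ n ih =>
    rw [Function.iterate_succ_apply', pow_succ, ← mul_assoc]
    exact lconv_le hw ih y

/-- **Sup bound for the convolution powers**: `w^{*(n+1)} ≤ (sup w) · (∫⁻ w)^n` pointwise. -/
theorem convPow_le (hw : Measurable w) (hA : ∀ s, w s ≤ A) (n : ℕ) (y : ℝ) :
    convPow w n y ≤ A * (∫⁻ t, w t) ^ n :=
  iterate_lconv_le hw hA n y

/-- Convolution with an EVEN weight preserves evenness. -/
theorem lconv_neg (hws : ∀ t, w (-t) = w t) (hφ : ∀ s, φ (-s) = φ s) (y : ℝ) :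
    lconv w φ (-y) = lconv w φ y := by
  rw [lconv, lconv, ← lintegral_neg_eq_self (fun t => φ (y - t) * w t)]
  refine lintegral_congr fun t => ?_
  simp only [sub_neg_eq_add, hws]
  rw [show -y - t = -(y + t) by ring, hφ]

/-- **The convolution powers of an even weight are even.** -/
theorem convPow_neg (hws : ∀ t, w (-t) = w t) (n : ℕ) (y : ℝ) :
    convPow w n (-y) = convPow w n y := by
  induction n generalizing y with
  | zero => exact hws y
  | succ n ih => rw [convPow_succ]; exact lconv_neg hws ih y

/-- `lconv w φ` does not see an a.e.-modification of `φ` (at ANY point `y`: the substitution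
`t ↦ y − t` preserves Lebesgue null sets). -/
theorem lconv_congr_ae_right (h : φ =ᵐ[volume] φ') (w : ℝ → ℝ≥0∞) : lconv w φ = lconv w φ' := by
  funext y
  rw [lconv_eq_lintegral_mul, lconv_eq_lintegral_mul]
  exact lintegral_congr_ae (h.mono fun t ht => by simp only [ht])

/-- `lconv w φ` does not see an a.e.-modification of the weight `w`. -/
theorem lconv_congr_ae_left (h : w =ᵐ[volume] w') (φ : ℝ → ℝ≥0∞) : lconv w φ = lconv w' φ := by
  funext y
  exact lintegral_congr_ae (h.mono fun t ht => by simp only [ht])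

/-- **The convolution powers `w^{*(n+1)}`, `n ≥ 1`, do not see an a.e.-modification of the
weight** (they agree EVERYWHERE, not just a.e.; `convPow w 0 = w` itself of course does). -/
theorem convPow_congr_ae (h : w =ᵐ[volume] w') {n : ℕ} (hn : 1 ≤ n) :
    convPow w n = convPow w' n := by
  -- auxiliary: a.e. agreement at every level
  have hae : ∀ m, convPow w m =ᵐ[volume] convPow w' m := by
    intro m
    induction m with
    | zero => exact h
    | succ m ih =>
      rw [convPow_succ, convPow_succ, lconv_congr_ae_right ih, lconv_congr_ae_left h]
  obtain ⟨m, rfl⟩ := Nat.exists_eq_add_of_le' hn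
  rw [convPow_succ, convPow_succ, lconv_congr_ae_right (hae m), lconv_congr_ae_left h]

/-! ### 3. Integrating out independent increments -/

/-- A factor that does not depend on the integrated coordinates comes out of `lmarginal`. -/
theorem lmarginal_mul_indep_real {ι : Type*} [DecidableEq ι] (R : Finset ι)
    {F c : (ι → ℝ) → ℝ≥0∞} (hF : Measurable F)
    (hc : ∀ x (y : (i : ↥R) → ℝ), c (Function.updateFinset x R y) = c x) :
    (∫⋯∫⁻_R, (fun z => F z * c z) ∂fun _ : ι => (volume : Measure ℝ)) =
      fun x => (∫⋯∫⁻_R, F ∂fun _ : ι => (volume : Measure ℝ)) x * c x := by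
  funext x
  simp only [lmarginal, hc]
  exact lintegral_mul_const (c x) (hF.comp measurable_updateFinset)

/-- **Integrating out the increments of `R`.**  For `a` measurable and independent of the
`R`-coordinates: `∫⋯∫_R φ(a − Σ_{r∈R} t_r) · ∏_{r∈R} w(t_r) dt_R = ((lconv w)^{#R} φ)(a)`. -/
theorem lmarginal_eq_iterate_lconv {ι : Type*} [DecidableEq ι] (hw : Measurable w)
    (hφ : Measurable φ) (R : Finset ι) {a : (ι → ℝ) → ℝ} (ham : Measurable a)
    (ha : ∀ t, ∀ r ∈ R, ∀ v, a (Function.update t r v) = a t) :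
    (∫⋯∫⁻_R, (fun t => φ (a t - ∑ r ∈ R, t r) * ∏ r ∈ R, w (t r))
        ∂fun _ : ι => (volume : Measure ℝ)) =
      fun t => (lconv w)^[R.card] φ (a t) := by
  classical
  induction R using Finset.induction_on generalizing a with
  | empty => funext t; simp
  | @insert r R hr ih =>
    funext t
    have hmeas : Measurable fun t : ι → ℝ =>
        φ (a t - ∑ r ∈ insert r R, t r) * ∏ r ∈ insert r R, w (t r) :=
      (hφ.comp (ham.sub (Finset.measurable_sum _ fun i _ => measurable_pi_apply i))).mul
        (Finset.measurable_prod _ fun i _ => hw.comp (measurable_pi_apply i))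
    rw [lmarginal_insert _ hmeas hr, Finset.card_insert_of_notMem hr,
      Function.iterate_succ_apply', lconv]
    -- the integrand as (inner function with `a' t = a t − t r`) * (the constant factor `w (t r)`)
    have hsplit : (fun t : ι → ℝ => φ (a t - ∑ r ∈ insert r R, t r) * ∏ r ∈ insert r R, w (t r)) =
        fun t => (φ ((a t - t r) - ∑ r ∈ R, t r) * ∏ r ∈ R, w (t r)) * w (t r) := by
      funext t
      rw [Finset.sum_insert hr, Finset.prod_insert hr, sub_sub]
      ring
    have ha' : ∀ t, ∀ r' ∈ R, ∀ v, (fun t : ι → ℝ => a t - t r) (Function.update t r' v) =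
        (fun t : ι → ℝ => a t - t r) t := by
      intro t r' hr' v
      have hne : r ≠ r' := fun h => hr (h ▸ hr')
      simp only [ha t r' (Finset.mem_insert_of_mem hr') v, Function.update_of_ne hne]
    have hF : Measurable fun t : ι → ℝ => φ ((a t - t r) - ∑ r ∈ R, t r) * ∏ r ∈ R, w (t r) :=
      (hφ.comp ((ham.sub (measurable_pi_apply r)).sub
        (Finset.measurable_sum _ fun i _ => measurable_pi_apply i))).mul
        (Finset.measurable_prod _ fun i _ => hw.comp (measurable_pi_apply i))
    have hc : ∀ x (y : (i : ↥R) → ℝ), (fun t : ι → ℝ => w (t r)) (Function.updateFinset x R y) =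
        (fun t : ι → ℝ => w (t r)) x := by
      intro x y; simp [Function.updateFinset, hr]
    have hm' : Measurable fun t : ι → ℝ => a t - t r := ham.sub (measurable_pi_apply r)
    have hih := ih (a := fun t => a t - t r) hm' ha'
    rw [hsplit, lmarginal_mul_indep_real R hF hc]
    refine lintegral_congr fun v => ?_
    show (∫⋯∫⁻_R, (fun t => φ ((a t - t r) - ∑ r ∈ R, t r) * ∏ r ∈ R, w (t r))
        ∂fun _ : ι => (volume : Measure ℝ)) (Function.update t r v) *
        w (Function.update t r v r) = _
    rw [congrFun hih (Function.update t r v)]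
    simp only [Function.update_self, ha t r (Finset.mem_insert_self r R) v]

/-- **The whole space**: for a finite index type `ι`,
`∫_{ℝ^ι} φ(y − Σ_i t_i) · ∏_i w(t_i) dt = ((lconv w)^{|ι|} φ)(y)`. -/
theorem lintegral_eq_iterate_lconv {ι : Type*} [Fintype ι] (hw : Measurable w) (hφ : Measurable φ)
    (y : ℝ) :
    ∫⁻ t : ι → ℝ, φ (y - ∑ i, t i) * ∏ i, w (t i) = (lconv w)^[Fintype.card ι] φ y := by
  classical
  have h := lmarginal_eq_iterate_lconv hw hφ (Finset.univ : Finset ι) (a := fun _ => y)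
    measurable_const (fun _ _ _ _ => rfl)
  rw [lmarginal_univ] at h
  have h' := congrFun h (fun _ => 0)
  rw [Finset.card_univ] at h'
  rw [← h', volume_pi]

/-- **The density of a sum of independent increments**: for a finite index type `ι`,
`∫_{ℝ^ι} w(y − Σ_i t_i) · ∏_i w(t_i) dt = (convPow w |ι|)(y) = w^{*(|ι|+1)}(y)`. -/
theorem lintegral_eq_convPow {ι : Type*} [Fintype ι] (hw : Measurable w) (y : ℝ) :
    ∫⁻ t : ι → ℝ, w (y - ∑ i, t i) * ∏ i, w (t i) = convPow w (Fintype.card ι) y :=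
  lintegral_eq_iterate_lconv hw hw y

end Summit.Ventures.LatticeQCDFlow.Scoring
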